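import Mathlib
import Literature.RepresentationTheory.FiniteGroups.CharacterDegrees
import Literature.RepresentationTheory.FiniteGroups.NonabelianCharDegree
import Literature.Barriers.MatrixMultiplication.QuasirandomBarrier
import Summits.MatrixMultiplication.MatrixMultiplication.Theorems.GradedDesignFamily.Negative.SlicedHorn
import Summits.MatrixMultiplication.MatrixMultiplication.Theorems.GradedDesignFamily.Negative.SL2Generators

/-!
# The minimal degree of `SL₂` over a finite field, and the unconditional sliced-horn bound
# (negative-side support for `stub_subfieldCell`, crux `GradedDesignFamily`, stmt-MatrixMultiplication-7610; file 2/2)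

Classical fact (Frobenius 1896 for `PSL₂(p)`; Schur 1907, Jordan 1907 for `SL₂(q)`): every irreducible
complex representation of `SL₂(F_Q)` of dimension `> 1` has dimension `≥ (Q−1)/2` (the least such
dimension is `(Q−1)/gcd(2,Q−1)`).  We prove the lower bound by the elementary torus-orbit argument:

* restrict an irreducible `ρ` to the upper unitriangular group `U ≅ (K,+)` and form, for a primitive
  additive character `ψ : K → ℂ` (`sl2md_exists_isPrimitive`: `x ↦ e(ℓ(x))` for a non-zero
  `F_p`-linear functional `ℓ`) and `a ∈ K`, the operators `E_a = Σ_x ψ(−a x) ρ(u_x)` (`|K|` times the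
  projector onto the `ψ(a·)`-eigenspace of `U`); they satisfy `ρ(u_y) E_a = ψ(a y) E_a`
  (`sl2md_upper_mul_E`), `Σ_a E_a = |K|·1` (`sl2md_sum_E`), `E_a E_b = |K|·[a = b]·E_b` (`sl2md_E_mul_E`),
  and the diagonal torus permutes them: `ρ(t_c) E_a = E_{a c⁻²} ρ(t_c)` (`sl2md_diag_mul_E`);
* if `E_a = 0` for all `a ≠ 0` then `U` acts trivially, hence (conjugating by the Weyl element,
  `sl2md_weyl_mul_upper`, and writing every element of `SL₂(K)` as a word in upper and lower
  unitriangulars, `sl2md_decomp`) `ρ` is trivial and, being irreducible, one-dimensional;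
* otherwise some `E_{a₀} ≠ 0`, `a₀ ≠ 0`, and then `E_b ≠ 0` for every `b ∈ a₀·(K^×)⁻²`; non-zero vectors
  in the ranges of these `E_b` are linearly independent, and `|a₀ (K^×)⁻²| ≥ (|K|−1)/2` (squaring is at
  most two-to-one), so `dim ρ ≥ (|K|−1)/2`.

Results: `sl2_card_sub_one_le_two_mul_of_mem_charDegrees` (`|K| − 1 ≤ 2d` for every irreducible degree
`d > 1`), `sl2_secondCharDegree_ge` (`(|K|−1)/2 ≤ n(SL₂ K)`, the infimum being attained by Serre's Thm 9,
tree theorem `Serre1977_thm9_holds`), and the UNCONDITIONAL form of the sliced-horn bound of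
`Negative/SlicedHorn.lean`: `slicedHorn_card_mul_le_uncond` —
`|X||Y||Z| ≤ √2·|SL₂ K|^{3/2}/√(|K|−1) + |SL₂ K|` for every TPP triple of `GL₂(K)` with `det = 1` on `X`
and `det` constant on `Y` and on `Z` (so the sliced horn of `stub_subfieldCell`, which needs
`≈ c²·|K|^{9/2}`, is empty for `|K| > 2/c⁴`).

Sorry-free; axioms `propext`, `Classical.choice`, `Quot.sound`.
-/

set_option linter.dupNamespace false

noncomputable section

open scoped BigOperators
open Module Literature.RepresentationTheory.FiniteGroups Literature.Barriers.MatrixMultiplication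

namespace Summit.MatrixMultiplication.MatrixMultiplication.Theorems.GradedDesignFamily.Negative

section SL2MinDegree

variable {K : Type} [Field K] [Fintype K]

/-! ## The eigen-operators `E_a = Σ_x ψ(−a x) ρ(u_x)` -/

variable {V : Type} [AddCommGroup V] [Module ℂ V]

omit [Fintype K] in
/-- `ρ(u_y) E_a = ψ(a y) E_a` (reindex `x ↦ y + x`). [folklore] -/
theorem sl2md_upper_mul_E [Fintype K] (ρ : Representation ℂ (Matrix.SpecialLinearGroup (Fin 2) K) V)
    (ψ : AddChar K ℂ) (a y : K) :
    ρ ⟨_, sl2md_det_upper y⟩ * (∑ x : K, ψ (-(a * x)) • ρ ⟨_, sl2md_det_upper x⟩) =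
      ψ (a * y) • ∑ x : K, ψ (-(a * x)) • ρ ⟨_, sl2md_det_upper x⟩ := by
  rw [Finset.mul_sum, Finset.smul_sum]
  -- the `x`-th term on the left is the `(y + x)`-th term on the right
  refine Fintype.sum_equiv (Equiv.addLeft y) _ _ fun x => ?_
  simp only [Equiv.coe_addLeft, mul_smul_comm]
  rw [← map_mul, sl2md_upper_mul, smul_smul, ← AddChar.map_add_eq_mul]
  congr 2
  ring

/-- `Σ_a E_a = |K| • 1`. [folklore] -/
theorem sl2md_sum_E (ρ : Representation ℂ (Matrix.SpecialLinearGroup (Fin 2) K) V)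
    {ψ : AddChar K ℂ} (hψ : ψ.IsPrimitive) :
    ∑ a : K, ∑ x : K, ψ (-(a * x)) • ρ ⟨_, sl2md_det_upper x⟩ =
      (Fintype.card K : ℂ) • (1 : V →ₗ[ℂ] V) := by
  classical
  rw [Finset.sum_comm]
  have : ∀ x : K, ∑ a : K, ψ (-(a * x)) • ρ ⟨_, sl2md_det_upper x⟩ =
      (if x = 0 then (Fintype.card K : ℂ) else 0) • ρ ⟨_, sl2md_det_upper x⟩ := by
    intro x
    rw [← Finset.sum_smul]
    congr 1
    have h := sl2md_sum_shift hψ (-x)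
    simp only [neg_eq_zero] at h
    rw [← h]
    exact Finset.sum_congr rfl fun a _ => by rw [mul_neg]
  simp only [this, ite_smul, zero_smul, Finset.sum_ite_eq', Finset.mem_univ, if_true]
  rw [sl2md_upper_zero, map_one]

/-- `E_a E_b = |K|·[a = b]·E_b`. [folklore] -/
theorem sl2md_E_mul_E [DecidableEq K] (ρ : Representation ℂ (Matrix.SpecialLinearGroup (Fin 2) K) V)
    {ψ : AddChar K ℂ} (hψ : ψ.IsPrimitive) (a b : K) :
    (∑ x : K, ψ (-(a * x)) • ρ ⟨_, sl2md_det_upper x⟩) *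
        (∑ x : K, ψ (-(b * x)) • ρ ⟨_, sl2md_det_upper x⟩) =
      (if a = b then (Fintype.card K : ℂ) else 0) •
        ∑ x : K, ψ (-(b * x)) • ρ ⟨_, sl2md_det_upper x⟩ := by
  rw [Finset.sum_mul]
  simp only [smul_mul_assoc, sl2md_upper_mul_E, smul_smul]
  rw [← Finset.sum_smul]
  congr 1
  have h := sl2md_sum_shift hψ (b - a)
  have hab : (b - a = 0) ↔ (a = b) := by rw [sub_eq_zero]; exact eq_comm
  simp only [hab] at h
  rw [← h]
  refine Finset.sum_congr rfl fun x _ => ?_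
  rw [← AddChar.map_add_eq_mul]
  congr 1; ring

omit [Fintype K] in
/-- The diagonal torus permutes the `E_a`: `ρ(t_c) E_a = E_{a c⁻²} ρ(t_c)`. [folklore] -/
theorem sl2md_diag_mul_E [Fintype K] (ρ : Representation ℂ (Matrix.SpecialLinearGroup (Fin 2) K) V)
    (ψ : AddChar K ℂ) (a : K) (c : Kˣ) :
    ρ ⟨_, sl2md_det_diag c⟩ * (∑ x : K, ψ (-(a * x)) • ρ ⟨_, sl2md_det_upper x⟩) =
      (∑ x : K, ψ (-(a * ((c : K) * c)⁻¹ * x)) • ρ ⟨_, sl2md_det_upper x⟩) * ρ ⟨_, sl2md_det_diag c⟩ := by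
  rw [Finset.mul_sum, Finset.sum_mul]
  have hcc : ((c : K) * c) ≠ 0 := mul_ne_zero c.ne_zero c.ne_zero
  -- the `x`-th term on the left is the `(c² x)`-th term on the right
  refine Fintype.sum_bijective (fun x => (c : K) * c * x) (mulLeft_bijective₀ _ hcc) _ _ fun x => ?_
  simp only [mul_smul_comm, smul_mul_assoc]
  rw [← map_mul, sl2md_diag_mul_upper, map_mul]
  have hx : a * ((c : K) * c)⁻¹ * ((c : K) * c * x) = a * x := by field_simp
  rw [hx]

/-! ## The minimal degree -/

/-- **Non-linear irreducible representations of `SL₂(K)` have dimension `≥ (|K|−1)/2`**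
(Frobenius 1896 / Schur 1907; elementary torus-orbit proof). [folklore] -/
theorem sl2_card_sub_one_le_two_mul_of_mem_charDegrees :
    ∀ d ∈ charDegrees (Matrix.SpecialLinearGroup (Fin 2) K), 1 < d → Fintype.card K - 1 ≤ 2 * d := by
  classical
  rintro d ⟨V, _, _, _, ρ, hρ, rfl⟩ hd
  obtain ⟨ψ, hψ⟩ := sl2md_exists_isPrimitive (K := K)
  set E : K → (V →ₗ[ℂ] V) := fun a => ∑ x : K, ψ (-(a * x)) • ρ ⟨_, sl2md_det_upper x⟩ with hE
  have hq : (Fintype.card K : ℂ) ≠ 0 := Nat.cast_ne_zero.2 Fintype.card_ne_zero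
  by_cases hcase : ∀ a : K, a ≠ 0 → E a = 0
  · -- Case A: `U` acts trivially, hence `ρ` is trivial, hence one-dimensional
    exfalso
    have hsum : E 0 = (Fintype.card K : ℂ) • (1 : V →ₗ[ℂ] V) := by
      rw [← sl2md_sum_E ρ hψ, Finset.sum_eq_single (0 : K)]
      · intro a _ ha; exact hcase a ha
      · intro h; exact absurd (Finset.mem_univ _) h
    have hU : ∀ y : K, ρ ⟨_, sl2md_det_upper y⟩ = 1 := by
      intro y
      have h := sl2md_upper_mul_E ρ ψ 0 y
      change ρ ⟨_, sl2md_det_upper y⟩ * E 0 = ψ (0 * y) • E 0 at h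
      rw [zero_mul, AddChar.map_zero_eq_one, one_smul, hsum, mul_smul_comm, mul_one] at h
      exact smul_right_injective (V →ₗ[ℂ] V) hq h
    have hL : ∀ y : K, ρ ⟨_, sl2md_det_lower y⟩ = 1 := by
      intro y
      have h := congrArg ρ (sl2md_weyl_mul_upper y)
      rw [map_mul, map_mul, hU, mul_one] at h
      -- `ρ w = ρ(l_y) ρ w`; cancel the unit `ρ w`
      have hw : ρ ⟨_, sl2md_det_weyl⟩ * ρ (⟨_, sl2md_det_weyl⟩⁻¹) = 1 := by
        rw [← map_mul, mul_inv_cancel, map_one]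
      calc ρ ⟨_, sl2md_det_lower y⟩
          = ρ ⟨_, sl2md_det_lower y⟩ * (ρ ⟨_, sl2md_det_weyl⟩ * ρ (⟨_, sl2md_det_weyl⟩⁻¹)) := by
            rw [hw, mul_one]
        _ = (ρ ⟨_, sl2md_det_lower y⟩ * ρ ⟨_, sl2md_det_weyl⟩) * ρ (⟨_, sl2md_det_weyl⟩⁻¹) := by
            rw [mul_assoc]
        _ = ρ ⟨_, sl2md_det_weyl⟩ * ρ (⟨_, sl2md_det_weyl⟩⁻¹) := by rw [← h]
        _ = 1 := hw
    have htriv : ∀ g, ρ g = 1 := by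
      intro g
      obtain ⟨a, b, c, e, rfl⟩ := sl2md_decomp g
      rw [map_mul, map_mul, map_mul, hU, hU, hL, hL, mul_one, mul_one, mul_one]
    -- an irreducible trivial representation is one-dimensional
    haveI := hρ
    have hV : Nontrivial V := by
      by_contra hs
      have : finrank ℂ V = 0 := by
        rw [not_nontrivial_iff_subsingleton] at hs
        exact Module.finrank_zero_of_subsingleton
      omega
    obtain ⟨v, hv⟩ := exists_ne (0 : V)
    let W : Subrepresentation ρ :=
      ⟨Submodule.span ℂ {v}, fun g w hw => by rw [htriv g]; exact hw⟩
    have hWtop : W = ⊤ := by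
      rcases IsSimpleOrder.eq_bot_or_eq_top W with h | h
      · exfalso
        have hmem : v ∈ W.toSubmodule := Submodule.mem_span_singleton_self v
        have hbot : W.toSubmodule = (⊥ : Subrepresentation ρ).toSubmodule := by rw [h]
        rw [hbot] at hmem
        exact hv ((Submodule.mem_bot ℂ).1 hmem)
      · exact h
    have hspan : Submodule.span ℂ {v} = (⊤ : Subrepresentation ρ).toSubmodule := by
      rw [← hWtop]
    have h1 : finrank ℂ V = 1 := by
      rw [← finrank_top, ← show Submodule.span ℂ {v} = (⊤ : Submodule ℂ V) from hspan,
        finrank_span_singleton hv]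
    omega
  · -- Case B: some `E_{a₀} ≠ 0` with `a₀ ≠ 0`; the torus orbit of `a₀` gives independent vectors
    push Not at hcase
    obtain ⟨a₀, ha₀, hEa₀⟩ := hcase
    -- `E_b ≠ 0` along the orbit `b = a₀ (c²)⁻¹`
    have horbit : ∀ c : Kˣ, E (a₀ * ((c : K) * c)⁻¹) ≠ 0 := by
      intro c hzero
      apply hEa₀
      have h := sl2md_diag_mul_E ρ ψ a₀ c
      change ρ ⟨_, sl2md_det_diag c⟩ * E a₀ = E (a₀ * ((c : K) * c)⁻¹) * ρ ⟨_, sl2md_det_diag c⟩ at h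
      rw [hzero, zero_mul] at h
      -- cancel the invertible `ρ(t_c)` on the left
      have hinv : ρ (⟨_, sl2md_det_diag c⟩⁻¹) * ρ ⟨_, sl2md_det_diag c⟩ = 1 := by
        rw [← map_mul, inv_mul_cancel, map_one]
      calc E a₀ = (ρ (⟨_, sl2md_det_diag c⟩⁻¹) * ρ ⟨_, sl2md_det_diag c⟩) * E a₀ := by
            rw [hinv, one_mul]
        _ = ρ (⟨_, sl2md_det_diag c⟩⁻¹) * (ρ ⟨_, sl2md_det_diag c⟩ * E a₀) := by rw [mul_assoc]
        _ = 0 := by rw [h, mul_zero]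
    -- the orbit as a finset and non-zero vectors in the ranges
    set orb : Finset K := Finset.univ.image (fun c : Kˣ => a₀ * ((c : K) * c)⁻¹) with horb
    have hne : ∀ b ∈ orb, ∃ w : V, E b w ≠ 0 := by
      intro b hb
      obtain ⟨c, -, rfl⟩ := Finset.mem_image.1 hb
      by_contra hall
      push Not at hall
      exact horbit c (LinearMap.ext hall)
    choose! w hw using hne
    -- linear independence of `b ↦ E_b (w b)` on the orbit
    have hli : LinearIndependent ℂ (fun b : orb => E b.1 (w b.1)) := by
      rw [linearIndependent_iff']
      intro s g hsum i hi
      have hEE : ∀ j : orb, E i.1 * E j.1 =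
          (if i.1 = j.1 then (Fintype.card K : ℂ) else 0) • E j.1 :=
        fun j => sl2md_E_mul_E ρ hψ i.1 j.1
      have happly := congrArg (E i.1) hsum
      rw [map_sum, map_zero] at happly
      have hterm : ∀ j ∈ s, E i.1 (g j • E j.1 (w j.1)) =
          if j = i then (g i * (Fintype.card K : ℂ)) • E i.1 (w i.1) else 0 := by
        intro j _
        rw [map_smul, ← Module.End.mul_apply, hEE j, LinearMap.smul_apply]
        by_cases hij : j = i
        · subst hij
          rw [if_pos rfl, if_pos rfl, smul_smul]
        · have hne : i.1 ≠ j.1 := fun h => hij (Subtype.ext h).symm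
          rw [if_neg hne, if_neg hij, zero_smul, smul_zero]
      rw [Finset.sum_congr rfl hterm, Finset.sum_ite_eq' s i, if_pos hi] at happly
      rcases smul_eq_zero.1 happly with h0 | h0
      · exact (mul_eq_zero.1 h0).resolve_right hq
      · exact absurd h0 (hw i.1 i.2)
    have hcard_le : orb.card ≤ finrank ℂ V := by
      have := hli.fintype_card_le_finrank
      rwa [Fintype.card_coe] at this
    -- `|Kˣ| ≤ 2 |orb|`: squaring is at most two-to-one
    have hfib : ∀ b ∈ orb, (Finset.univ.filter (fun c : Kˣ => a₀ * ((c : K) * c)⁻¹ = b)).card ≤ 2 := by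
      intro b hb
      obtain ⟨c₀, -, rfl⟩ := Finset.mem_image.1 hb
      have hsub : (Finset.univ.filter (fun c : Kˣ => a₀ * ((c : K) * c)⁻¹ = a₀ * ((c₀ : K) * c₀)⁻¹)) ⊆
          {c₀, -c₀} := by
        intro c hc
        rw [Finset.mem_filter] at hc
        have h := hc.2
        rw [mul_right_inj' ha₀, inv_inj] at h
        have h' : ((c : K) - c₀) * ((c : K) + c₀) = 0 := by linear_combination h
        rcases mul_eq_zero.1 h' with h1 | h1
        · rw [Finset.mem_insert]; left
          exact Units.ext (sub_eq_zero.1 h1)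
        · rw [Finset.mem_insert, Finset.mem_singleton]; right
          apply Units.ext; rw [Units.val_neg]; linear_combination h1
      calc (Finset.univ.filter (fun c : Kˣ => a₀ * ((c : K) * c)⁻¹ = a₀ * ((c₀ : K) * c₀)⁻¹)).card
          ≤ ({c₀, -c₀} : Finset Kˣ).card := Finset.card_le_card hsub
        _ ≤ 2 := Finset.card_le_two
    have hunits : Fintype.card Kˣ ≤ 2 * orb.card := by
      have := Finset.card_le_mul_card_image (Finset.univ : Finset Kˣ) 2 hfib
      rwa [Finset.card_univ] at this
    rw [Fintype.card_units] at hunits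
    omega

/-- **`n(SL₂(K)) ≥ (|K|−1)/2`**: the second-smallest character degree of `SL₂` over a finite field
(BCGPU 2023, Def. 3.1) is at least `(|K|−1)/2` (infimum attained: Serre's Thm 9, `Serre1977_thm9_holds`,
and `SL₂(K)` is nonabelian). [folklore] -/
theorem sl2_secondCharDegree_ge :
    ((Fintype.card K : ℝ) - 1) / 2 ≤ secondCharDegree (Matrix.SpecialLinearGroup (Fin 2) K) := by
  classical
  have hna : ∃ a b : Matrix.SpecialLinearGroup (Fin 2) K, a * b ≠ b * a := by
    refine ⟨⟨!![1, 1; 0, 1], by simp [Matrix.det_fin_two_of]⟩,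
      ⟨!![1, 0; 1, 1], by simp [Matrix.det_fin_two_of]⟩, fun h => ?_⟩
    have h00 := congrArg (fun M : Matrix.SpecialLinearGroup (Fin 2) K => (M : Matrix (Fin 2) (Fin 2) K) 0 0) h
    simp [Matrix.mul_apply, Fin.sum_univ_two] at h00
  have hne : {d : ℕ | d ∈ charDegrees (Matrix.SpecialLinearGroup (Fin 2) K) ∧ 1 < d}.Nonempty := by
    obtain ⟨d, hd, h1⟩ := Serre1977_thm9.exists_one_lt_mem_charDegrees Serre1977_thm9_holds
      (Matrix.SpecialLinearGroup (Fin 2) K) hna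
    exact ⟨d, hd, h1⟩
  have hmem := Nat.sInf_mem hne
  have hmem' : secondCharDegree (Matrix.SpecialLinearGroup (Fin 2) K) ∈
      charDegrees (Matrix.SpecialLinearGroup (Fin 2) K) ∧
      1 < secondCharDegree (Matrix.SpecialLinearGroup (Fin 2) K) := hmem
  have h := sl2_card_sub_one_le_two_mul_of_mem_charDegrees _ hmem'.1 hmem'.2
  have h1 : 1 ≤ Fintype.card K := Fintype.card_pos
  have hcast : ((Fintype.card K - 1 : ℕ) : ℝ) = (Fintype.card K : ℝ) - 1 := by
    rw [Nat.cast_sub h1, Nat.cast_one]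
  have h' : ((Fintype.card K : ℝ) - 1) ≤ 2 * (secondCharDegree (Matrix.SpecialLinearGroup (Fin 2) K) : ℝ) := by
    rw [← hcast]; exact_mod_cast h
  linarith

/-- **The sliced horn of `stub_subfieldCell` is dead, unconditionally.**  For every finite field `K`
and every triple `(X, Y, Z)` with the triple product property in `GL₂(K)` such that `det = 1` on `X` and
`det` is constant on `Y` and on `Z`:  `|X||Y||Z| ≤ √2·|SL₂ K|^{3/2}/√(|K|−1) + |SL₂ K|` (`≈ √2·|K|⁴`).
[cite: BlasiakCohnGrochowPrattUmans2023, Thm. 3.2] -/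
theorem slicedHorn_card_mul_le_uncond [DecidableEq K] (X Y Z : Finset (Matrix.GeneralLinearGroup (Fin 2) K))
    (hT : Literature.Combinatorics.Additive.TripleProductProperty X Y Z)
    (hX : ∀ x ∈ X, Matrix.GeneralLinearGroup.det x = 1)
    (hY : ∀ y ∈ Y, ∀ y' ∈ Y, Matrix.GeneralLinearGroup.det y = Matrix.GeneralLinearGroup.det y')
    (hZ : ∀ z ∈ Z, ∀ z' ∈ Z, Matrix.GeneralLinearGroup.det z = Matrix.GeneralLinearGroup.det z') :
    ((X.card * Y.card * Z.card : ℕ) : ℝ) ≤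
      Real.sqrt 2 * (Fintype.card (Matrix.SpecialLinearGroup (Fin 2) K) : ℝ) ^ (3 / 2 : ℝ) /
          Real.sqrt ((Fintype.card K : ℝ) - 1) +
        Fintype.card (Matrix.SpecialLinearGroup (Fin 2) K) :=
  slicedHorn_card_mul_le_of_minDegree K X Y Z hT hX hY hZ Fintype.one_lt_card sl2_secondCharDegree_ge

end SL2MinDegree

end Summit.MatrixMultiplication.MatrixMultiplication.Theorems.GradedDesignFamily.Negative

end
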